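import Mathlib.Analysis.Normed.Module.FiniteDimension
import Summits.AtomisticToContinuum.Crystallization.Theorems.CoarseGrains.Negative.PredicateAPI

/-!
# Line `Sketch` (crux `FineGrains`, stmt-AtomisticToContinuum-9330): the chart dictionary at tolerance `ε`

Stub `stub_isoDictionaryAt` of the line skeleton (pure algebra over `BarlowStacking.lean`); it is the
landed `stub_isoDictionary` of the truss line (crux `CoarseGrains`,
`Theorems/ExcessDecayLiouvilleCoarseGrainsIsoDictionary.lean`) with the matching tolerance `1/40`
replaced by a parameter `ε`, the centre `x i` made explicit, and the conclusion phrased with the crux's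
named predicates `Adm`, `Inner`, `Near`, `Lam` of `Theorems.CoarseGrains.Negative.PredicateAPI`
(verbatim the crux's `let`s).

The crux `FineGrains` asks, for every `(ρ, ε)`, for a ball two-way `ε`-matched with an *admissible
affine hcp two-lattice datum* `(c, t, A')`: sites `t m + A' z` (`m : Fin 2`,
`z ∈ Lam = ℤ u₁ + ℤ v₁ + ℤ (2√(2/3)) e₃`, `u₁ = triangularVec₁ 1`, `v₁ = triangularVec₂ 1`),
`Adm A' := ∃ isometry R, ‖A' − 0.97 • R‖ ≤ 1/40` (operator norm) and
`Inner t A' := ‖t 1 − t 0 − A' (barlowOffset 1 + layerNormal √(2/3))‖ ≤ 1/40`.  The sibling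
reduction produces instead an *origin-based isometric chart*: a particle `x i` and a linear isometry
`A` with the particles within `R` of `x i` two-way `ε`-matched to `x i + A (hcp(a,h))`, where `(a, h)`
lies in the window `|a − 0.97| ≤ 1/40`, `|h/√(2/3) − 0.97| ≤ 1/40`.

The dictionary (this file): centre `c = x i`, sublattice origins `t 0 = x i`,
`t 1 = x i + A (barlowOffset a + layerNormal h)`, cell map `A' = A ∘ D` with the diagonal map
`D = diag(a, a, h/√(2/3))`.  Then `D` maps `Lam` onto the even layers of `hcp(a,h)` and
`barlowOffset a + layerNormal h + D Lam` is the union of the odd layers (`haggLabel_alternating`),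
so the two matching clauses translate literally at any tolerance `ε` (a site within `R` of `x i` is
`x i + A p` with `‖p‖ ≤ R`, `A` being an isometry); `Inner t A'` holds with norm `0`; and `Adm A'`
holds with the isometry `A` itself (`LinearIsometry.toLinearIsometryEquiv`), since
`‖(A ∘ D − 0.97 • A) z‖ = ‖(D − 0.97) z‖ ≤ max(|a − 0.97|, |h/√(2/3) − 0.97|) ‖z‖ ≤ ‖z‖/40`.
All `[folklore]`.  Deliberately NOT here: anything about ground states (the stub is pure bookkeeping).
-/

noncomputable section

namespace Summit.AtomisticToContinuum.Crystallization.Theorems.ExcessDecayLiouvilleFineGrains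

open Literature.MathematicalPhysics.StatisticalMechanics
open Summit.AtomisticToContinuum.Crystallization.Theorems.CoarseGrains.Negative.PredicateAPI

/-- The diagonal map `diag(a, a, c)` of `ℝ³` exists as a continuous linear map. [folklore] -/
private theorem exists_diagAt (a c : ℝ) :
    ∃ D : E3 →L[ℝ] E3,
      (∀ z, D z 0 = a * z 0) ∧ (∀ z, D z 1 = a * z 1) ∧ (∀ z, D z 2 = c * z 2) :=
  ⟨LinearMap.toContinuousLinearMap
    { toFun := fun z => WithLp.toLp 2 fun k => (![a, a, c] : Fin 3 → ℝ) k * z k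
      map_add' := fun z w => by ext k; simp [mul_add]
      map_smul' := fun r z => by ext k; simp [mul_left_comm] },
    fun _ => rfl, fun _ => rfl, fun _ => rfl⟩

section Diag

variable {a c s : ℝ} {D : E3 →L[ℝ] E3}

/-- Pointwise estimate `‖(D − r) z‖ ≤ δ ‖z‖` for `D = diag(a, a, c)` with `|a − r|, |c − r| ≤ δ`.
[folklore] -/
private theorem norm_diagAt_sub_smul_le (hD0 : ∀ z, D z 0 = a * z 0) (hD1 : ∀ z, D z 1 = a * z 1)
    (hD2 : ∀ z, D z 2 = c * z 2) {r δ : ℝ} (hδ : 0 ≤ δ) (ha : |a - r| ≤ δ) (hc : |c - r| ≤ δ)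
    (z : E3) : ‖D z - r • z‖ ≤ δ * ‖z‖ := by
  have ha2 : (a - r) ^ 2 ≤ δ ^ 2 := by
    rw [← sq_abs]; exact pow_le_pow_left₀ (abs_nonneg _) ha 2
  have hc2 : (c - r) ^ 2 ≤ δ ^ 2 := by
    rw [← sq_abs]; exact pow_le_pow_left₀ (abs_nonneg _) hc 2
  have hsq : ‖D z - r • z‖ ^ 2 ≤ (δ * ‖z‖) ^ 2 := by
    rw [EuclideanSpace.real_norm_sq_eq, mul_pow, EuclideanSpace.real_norm_sq_eq,
      Fin.sum_univ_three, Fin.sum_univ_three]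
    simp only [PiLp.sub_apply, PiLp.smul_apply, smul_eq_mul, hD0, hD1, hD2]
    nlinarith [mul_le_mul_of_nonneg_right ha2 (sq_nonneg (z 0)),
      mul_le_mul_of_nonneg_right ha2 (sq_nonneg (z 1)),
      mul_le_mul_of_nonneg_right hc2 (sq_nonneg (z 2))]
  exact (pow_le_pow_iff_left₀ (norm_nonneg _) (by positivity) two_ne_zero).1 hsq

/-- `D = diag(a, a, c)` maps the point `i u₁ + j v₁ + 2 r s e₃` of the unit cell lattice to the
point `(i, j)` of the even layer `2r` of `hcp(a, c s)`. [folklore] -/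
private theorem barlowPos_two_mul_eq_diagAt (hD0 : ∀ z, D z 0 = a * z 0)
    (hD1 : ∀ z, D z 1 = a * z 1) (hD2 : ∀ z, D z 2 = c * z 2) (r i j : ℤ) :
    barlowPos a (c * s) alternatingHagg (2 * r) i j =
      D ((i : ℝ) • triangularVec₁ 1 + (j : ℝ) • triangularVec₂ 1 +
        (r : ℝ) • layerNormal (2 * s)) := by
  have hL : haggLabel alternatingHagg (2 * r) = 0 := by
    rw [haggLabel_alternating, if_pos (even_two_mul r)]
  ext l
  fin_cases l <;> simp [hD0, hD1, hD2, hL, triangularVec₁, triangularVec₂, layerNormal] <;> ring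

/-- `barlowOffset a + layerNormal (c s) + D (i u₁ + j v₁ + 2 r s e₃)` is the point `(i, j)` of
the odd layer `2r + 1` of `hcp(a, c s)`. [folklore] -/
private theorem barlowPos_two_mul_add_one_eq_diagAt (hD0 : ∀ z, D z 0 = a * z 0)
    (hD1 : ∀ z, D z 1 = a * z 1) (hD2 : ∀ z, D z 2 = c * z 2) (r i j : ℤ) :
    barlowPos a (c * s) alternatingHagg (2 * r + 1) i j =
      barlowOffset a + layerNormal (c * s) + D ((i : ℝ) • triangularVec₁ 1 +
        (j : ℝ) • triangularVec₂ 1 + (r : ℝ) • layerNormal (2 * s)) := by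
  have hL : haggLabel alternatingHagg (2 * r + 1) = 1 := by
    rw [haggLabel_alternating, if_neg (Int.not_even_two_mul_add_one r)]
  ext l
  fin_cases l <;>
    simp [hD0, hD1, hD2, hL, triangularVec₁, triangularVec₂, barlowOffset, layerNormal] <;> ring

/-- `D (barlowOffset 1 + layerNormal s) = barlowOffset a + layerNormal (c s)`. [folklore] -/
private theorem diagAt_offset (hD0 : ∀ z, D z 0 = a * z 0) (hD1 : ∀ z, D z 1 = a * z 1)
    (hD2 : ∀ z, D z 2 = c * z 2) :
    D (barlowOffset 1 + layerNormal s) = barlowOffset a + layerNormal (c * s) := by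
  ext l
  fin_cases l <;> simp [hD0, hD1, hD2, barlowOffset, layerNormal] <;> ring

end Diag

/-- **The dictionary in reduced form, at tolerance `ε`.** For `hcp(a, c s)` with
`|a − 0.97|, |c − 0.97| ≤ 1/40`, an origin-based isometric `ε`-chart of radius `R` at the particle
`x i` yields an admissible affine two-lattice datum centred at `x i` (`Λ` any set with the stated
membership, cell height `2s`, inner offset `barlowOffset 1 + layerNormal s`), two-way `ε`-matched on
the `R`-ball. [folklore] -/
private theorem datum_of_chartAt {a c s : ℝ} (hwa : |a - 97 / 100| ≤ 1 / 40)
    (hwc : |c - 97 / 100| ≤ 1 / 40) {Λ : Set E3}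
    (hΛ : ∀ z, z ∈ Λ ↔ ∃ i j k : ℤ, z = (i : ℝ) • triangularVec₁ 1 +
      (j : ℝ) • triangularVec₂ 1 + (k : ℝ) • layerNormal (2 * s))
    (ε : ℝ) {N : ℕ} (x : Fin N → E3) (i : Fin N) (R : ℝ) (A : E3 →ₗᵢ[ℝ] E3)
    (h1 : ∀ p ∈ hcpStacking a (c * s), ‖p‖ ≤ R → ∃ j : Fin N, dist (x j) (x i + A p) ≤ ε)
    (h2 : ∀ j : Fin N, dist (x j) (x i) ≤ R →
      ∃ p ∈ hcpStacking a (c * s), dist (x j) (x i + A p) ≤ ε) :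
    ∃ (t : Fin 2 → E3) (A' : E3 →L[ℝ] E3),
      (∃ R₀ : E3 ≃ₗᵢ[ℝ] E3,
        ‖A' - (97 / 100 : ℝ) • (R₀.toContinuousLinearEquiv : E3 →L[ℝ] E3)‖ ≤ 1 / 40) ∧
      ‖t 1 - t 0 - A' (barlowOffset 1 + layerNormal s)‖ ≤ 1 / 40 ∧
      ((∀ p ∈ Set.range x, dist p (x i) ≤ R → ∃ m : Fin 2, ∃ z ∈ Λ, dist p (t m + A' z) ≤ ε) ∧
        (∀ m : Fin 2, ∀ z ∈ Λ, dist (t m + A' z) (x i) ≤ R →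
          ∃ p ∈ Set.range x, dist p (t m + A' z) ≤ ε)) := by
  obtain ⟨D, hD0, hD1, hD2⟩ := exists_diagAt a c
  obtain ⟨off, hoff0, hoff1⟩ : ∃ off : Fin 2 → E3, off 0 = 0 ∧
      off 1 = barlowOffset a + layerNormal (c * s) := ⟨![0, _], rfl, rfl⟩
  -- sites ↔ points of the stacking
  have G1 : ∀ q ∈ hcpStacking a (c * s), ∃ m : Fin 2, ∃ z ∈ Λ, q = off m + D z := by
    rintro q ⟨k, i', j', rfl⟩
    rcases Int.even_or_odd k with ⟨r, rfl⟩ | ⟨r, rfl⟩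
    · refine ⟨0, _, (hΛ _).2 ⟨i', j', r, rfl⟩, ?_⟩
      rw [← two_mul, barlowPos_two_mul_eq_diagAt hD0 hD1 hD2, hoff0, zero_add]
    · refine ⟨1, _, (hΛ _).2 ⟨i', j', r, rfl⟩, ?_⟩
      rw [barlowPos_two_mul_add_one_eq_diagAt hD0 hD1 hD2, hoff1]
  have G2 : ∀ m : Fin 2, ∀ z ∈ Λ, off m + D z ∈ hcpStacking a (c * s) := by
    refine Fin.forall_fin_two.2 ⟨fun z hz => ?_, fun z hz => ?_⟩
    · obtain ⟨i', j', k, rfl⟩ := (hΛ z).1 hz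
      rw [hoff0, zero_add]
      exact ⟨2 * k, i', j', (barlowPos_two_mul_eq_diagAt hD0 hD1 hD2 k i' j').symm⟩
    · obtain ⟨i', j', k, rfl⟩ := (hΛ z).1 hz
      rw [hoff1]
      exact ⟨2 * k + 1, i', j', (barlowPos_two_mul_add_one_eq_diagAt hD0 hD1 hD2 k i' j').symm⟩
  have hA' : ∀ m z, x i + A (off m) + (A.toContinuousLinearMap.comp D) z =
      x i + A (off m + D z) := fun m z => by
    simp [add_assoc]
  refine ⟨fun m => x i + A (off m), A.toContinuousLinearMap.comp D, ?_, ?_, ?_, ?_⟩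
  · -- admissibility, with the isometry `A` itself
    refine ⟨A.toLinearIsometryEquiv rfl,
      ContinuousLinearMap.opNorm_le_bound _ (by norm_num) fun z => ?_⟩
    have : (A.toContinuousLinearMap.comp D - (97 / 100 : ℝ) •
        ((A.toLinearIsometryEquiv rfl).toContinuousLinearEquiv : E3 →L[ℝ] E3)) z =
        A (D z - (97 / 100 : ℝ) • z) := by
      simp [LinearIsometry.map_sub]
    rw [this, A.norm_map]
    exact norm_diagAt_sub_smul_le hD0 hD1 hD2 (by norm_num) hwa hwc z
  · -- the inner offset is exact
    have : x i + A (off 1) - (x i + A (off 0)) -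
        (A.toContinuousLinearMap.comp D) (barlowOffset 1 + layerNormal s) = 0 := by
      rw [hoff0, hoff1, ContinuousLinearMap.comp_apply, diagAt_offset hD0 hD1 hD2]
      simp
    simp only [this, norm_zero]
    norm_num
  · -- particles near the centre are near sites
    rintro p ⟨j, rfl⟩ hj
    obtain ⟨q, hq, hdist⟩ := h2 j hj
    obtain ⟨m, z, hz, rfl⟩ := G1 q hq
    exact ⟨m, z, hz, by rwa [hA']⟩
  · -- sites near the centre are near particles
    intro m z hz hR
    rw [hA'] at hR ⊢
    rw [dist_eq_norm, add_sub_cancel_left, A.norm_map] at hR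
    obtain ⟨j, hj⟩ := h1 _ (G2 m z hz) hR
    exact ⟨x j, Set.mem_range_self j, hj⟩

/-- The dictionary at tolerance `ε` with the hcp point set presented as
`(hcpPeriodicConfiguration ha hh).points`, the window in the `(a, h)` form and the conclusion over the
crux's named predicates `Adm`, `Inner`, `Near` (which unfold definitionally): reduction to
`datum_of_chartAt` via `hcpPeriodicConfiguration_points` and `h = c √(2/3)`, `c = h / √(2/3)`.
[folklore] -/
private theorem dictionaryAt_of_points {a h : ℝ} (ha : a ≠ 0) (hh : h ≠ 0)
    (hwa : |a - 97 / 100| ≤ 1 / 40) (hwh : |h / Real.sqrt (2 / 3) - 97 / 100| ≤ 1 / 40)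
    (ε : ℝ) {N : ℕ} (x : Fin N → E3) (i : Fin N) (R : ℝ)
    (hA : ∃ A : E3 →ₗᵢ[ℝ] E3,
      (∀ p ∈ (hcpPeriodicConfiguration ha hh).points, ‖p‖ ≤ R →
        ∃ j : Fin N, dist (x j) (x i + A p) ≤ ε) ∧
      (∀ j : Fin N, dist (x j) (x i) ≤ R →
        ∃ p ∈ (hcpPeriodicConfiguration ha hh).points, dist (x j) (x i + A p) ≤ ε)) :
    ∃ (t : Fin 2 → E3) (A' : E3 →L[ℝ] E3), Adm A' ∧ Inner t A' ∧
      Near (Set.range x) (x i) R t A' ε := by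
  rw [hcpPeriodicConfiguration_points] at hA
  obtain ⟨A, h1, h2⟩ := hA
  have hs : (0 : ℝ) < Real.sqrt (2 / 3) := Real.sqrt_pos.2 (by norm_num)
  obtain ⟨c, rfl⟩ : ∃ c : ℝ, h = c * Real.sqrt (2 / 3) :=
    ⟨h / Real.sqrt (2 / 3), (div_mul_cancel₀ h hs.ne').symm⟩
  rw [mul_div_cancel_right₀ c hs.ne'] at hwh
  exact datum_of_chartAt hwa hwh (fun _ => Iff.rfl) ε x i R A h1 h2

/-- **Stub `stub_isoDictionaryAt` — the isometric-chart dictionary at tolerance `ε`** (line `Sketch`,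
crux `FineGrains`, sibling reduction; the landed `stub_isoDictionary` of the truss line with the
matching tolerance `1/40` replaced by a parameter `ε` and the centre made explicit): for `(a, h)` in
the admissible window `|a − 0.97| ≤ 1/40`, `|h/√(2/3) − 0.97| ≤ 1/40`, an origin-based chart of
particle `x i` onto `x i + A (hcp(a,h))`, `A` a linear isometry, two-way `ε`-matched at radius `R`,
IS a datum of the crux at tolerance `ε`: centre `x i`, sublattice origins `x i` and
`x i + A (barlowOffset a + layerNormal h)`, cell map `A ∘ diag(a, a, h/√(2/3))` (which maps the cell
lattice `Lam` onto the even layers of `hcp(a,h)`, `haggLabel_alternating`); `Inner` holds with norm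
`0`, `Adm` with the isometry `A` itself
(`‖A ∘ D − 0.97 • A‖ = ‖D − 0.97‖ ≤ max(|a − 0.97|, |h/√(2/3) − 0.97|) ≤ 1/40`), and the two
matching clauses of `Near` translate literally. [folklore] -/
theorem stub_isoDictionaryAt :
    ∀ (a h : ℝ) (ha : a ≠ 0) (hh : h ≠ 0),
    |a - 97 / 100| ≤ 1 / 40 → |h / Real.sqrt (2 / 3) - 97 / 100| ≤ 1 / 40 →
    ∀ (ε : ℝ) (N : ℕ) (x : Fin N → E3) (i : Fin N) (R : ℝ),
    (∃ A : E3 →ₗᵢ[ℝ] E3,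
      (∀ p ∈ (hcpPeriodicConfiguration ha hh).points, ‖p‖ ≤ R →
        ∃ j : Fin N, dist (x j) (x i + A p) ≤ ε) ∧
      (∀ j : Fin N, dist (x j) (x i) ≤ R →
        ∃ p ∈ (hcpPeriodicConfiguration ha hh).points, dist (x j) (x i + A p) ≤ ε)) →
    ∃ (t : Fin 2 → E3) (A' : E3 →L[ℝ] E3), Adm A' ∧ Inner t A' ∧
      Near (Set.range x) (x i) R t A' ε := by
  intro a h ha hh hwa hwh ε N x i R hA
  exact dictionaryAt_of_points ha hh hwa hwh ε x i R hA

end Summit.AtomisticToContinuum.Crystallization.Theorems.ExcessDecayLiouvilleFineGrains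

end
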